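import Summits.QuantumFields.QCD.Theorems.GaussianLinkFramesFrameFMClosureTwoStarOfPaddedAux9
import Summits.QuantumFields.QCD.Theorems.GaussianLinkFramesFrameFMClosurePlacementSidesAux1

/-!
# Crux `GaussianLinkFrames.FrameFMClosure` (stmt-QuantumFields-17375), line `pad-the-fibre`, stub
`stub_placementSides` — helper 2: canonical pad regions with frozen layers, balance by pairings with rungs, and the
first-coordinate flip

* §1 CANONICAL REGIONS.  For a pad centre `x'` and frozen data `(M, c)` (`c μ ∈ {-2, 1}`: the bottom or top layer of
  the pad in direction `μ`), the FORCED links (pad links with no frozen endpoint) together with any set of RUNGS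
  (pad links with at most one frozen endpoint) form a canonical pad region (`isPadRegion_forced_union`); the forced
  links are exactly the links between two INTERIOR sites (`mem_forced_iff`); the interior `pad ∖ frozen` is read in
  the coordinate chart (`mem_interior_iff_val`); a core site not adjacent to the frozen layers has its whole star made
  of forced links (`star_subset_forced`); the region `stars ∪ Q₁ ∪ Q₂` has `≤ 2064` links (`card_region_le`).
* §2 BALANCE BY AN `R`-PAIRING (`balanced_touched_of_pairing`): if every site of `A` lying in one of two blocks or on
  a rung is paired by `σ` with a nearest neighbour in `A` through a link of `R` (inside a block, or a rung), then the
  touched region of `R` in `A` is bipartite-balanced — the version of helper 5's `balanced_touched_of_blocks` that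
  allows rungs.
* §3 THE FIRST-COORDINATE FLIP (`first_coord_flip`): flipping the first coordinate satisfying a predicate stable under
  its flip is a nearest-neighbour involution (the pairing behind the ball-complement and the antipodal placements).

References: elementary [folklore]; the pad recipe is the line card of `pad-the-fibre`.
-/

noncomputable section

open scoped BigOperators
open Literature.MathematicalPhysics.QuantumFieldTheory Literature.MathematicalPhysics.QuantumLattice
  Literature.Probability.LatticeModels
open Summit.QuantumFields.QCD.Theorems.VonMisesCircles Summit.QuantumFields.QCD.Theorems.PadTheFibre

namespace Summit.QuantumFields.QCD.Theorems.PadTheFibreTwoStar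

/-! ## §1 Canonical pad regions with frozen layers -/

open Classical in
/-- **Forced links plus rungs form a canonical pad region.**  With frozen data `(M, c)`, `c μ ∈ {-2, 1}`, the pad
links with no frozen endpoint together with any set `Rg` of pad links not joining two frozen sites satisfy
`IsPadRegion`. [folklore] -/
theorem isPadRegion_forced_union {S : ℕ} (x' : TorusSite 4 (2 * S + 1)) (M : Finset (Fin 4)) (c : Fin 4 → ℤ)
    (hc : ∀ μ ∈ M, c μ = -2 ∨ c μ = 1) (Rg : Finset (Edge 4 (2 * S + 1)))
    (hRg : Rg ⊆ (padLinks S x').filter fun e : Edge 4 (2 * S + 1) =>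
        ¬ (e.1 ∈ padFrozen S x' M c ∧ e.1.shift e.2 ∈ padFrozen S x' M c)) :
    IsPadRegion S x' (((padLinks S x').filter fun e : Edge 4 (2 * S + 1) =>
        e.1 ∉ padFrozen S x' M c ∧ e.1.shift e.2 ∉ padFrozen S x' M c) ∪ Rg) := by
  refine ⟨M, c, hc, Finset.subset_union_left, ?_⟩
  refine Finset.union_subset ?_ hRg
  intro e he
  rw [Finset.mem_filter] at he ⊢
  exact ⟨he.1, fun h => he.2.1 h.1⟩

open Classical in
/-- The forced links are exactly the links between two interior sites `pad ∖ frozen`. [folklore] -/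
theorem mem_forced_iff {S : ℕ} (x' : TorusSite 4 (2 * S + 1)) (M : Finset (Fin 4)) (c : Fin 4 → ℤ)
    (e : Edge 4 (2 * S + 1)) :
    e ∈ ((padLinks S x').filter fun e : Edge 4 (2 * S + 1) =>
        e.1 ∉ padFrozen S x' M c ∧ e.1.shift e.2 ∉ padFrozen S x' M c) ↔
      e.1 ∈ ebox S x' 1 \ padFrozen S x' M c ∧ e.1.shift e.2 ∈ ebox S x' 1 \ padFrozen S x' M c := by
  rw [Finset.mem_filter, Finset.mem_sdiff, Finset.mem_sdiff]
  unfold padLinks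
  rw [Finset.mem_filter]
  exact ⟨fun h => ⟨⟨h.1.2.1, h.2.1⟩, ⟨h.1.2.2, h.2.2⟩⟩, fun h => ⟨⟨Finset.mem_univ _, h.1.1, h.2.1⟩, h.1.2, h.2.2⟩⟩

/-- **Chart of the frozen layers** (`2 ≤ S`): a pad site `y` is frozen iff some selected coordinate offset equals the
selected layer, `(y μ - x' μ + 2).val = c μ + 2` for some `μ ∈ M` (with `c μ ∈ [-2, 1]`). [folklore] -/
theorem mem_padFrozen_iff_val {S : ℕ} (hS : 2 ≤ S) (x' y : TorusSite 4 (2 * S + 1)) (M : Finset (Fin 4))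
    (c : Fin 4 → ℤ) (hy : y ∈ ebox S x' 1) :
    y ∈ padFrozen S x' M c ↔ ∃ μ ∈ M, ((y μ - x' μ + 2).val : ℤ) = c μ + 2 := by
  classical
  haveI : NeZero (2 * S + 1) := ⟨by omega⟩
  have hval : ∀ (w : Site 4) (i : Fin 4), -2 ≤ w i → w i ≤ 1 →
      (((x' + Torus.proj (2 * S + 1) w) i - x' i + 2).val : ℤ) = w i + 2 := by
    intro w i h1 h2
    have e : (x' + Torus.proj (2 * S + 1) w) i - x' i + 2 = (((w i + 2).toNat : ℕ) : ZMod (2 * S + 1)) := by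
      rw [← Int.cast_natCast ((w i + 2).toNat), Int.toNat_of_nonneg (by omega)]
      simp only [Pi.add_apply, Torus.proj_apply, add_sub_cancel_left]
      push_cast; ring
    rw [e, ZMod.val_cast_of_lt (by omega)]
    omega
  constructor
  · intro h
    simp only [padFrozen, Finset.mem_image, Finset.mem_filter, Fintype.mem_piFinset, Finset.mem_Icc] at h
    obtain ⟨w, ⟨hw, μ, hμ, hwμ⟩, rfl⟩ := h
    exact ⟨μ, hμ, by rw [hval w μ (hw μ).1 (hw μ).2, hwμ]⟩
  · rintro ⟨μ, hμ, hμv⟩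
    obtain ⟨w, hw0, rfl⟩ := (mem_ebox_iff _ _ _).1 hy
    have hw : ∀ i, -2 ≤ w i ∧ w i ≤ 1 := fun i => by have := hw0 i; push_cast at this; omega
    simp only [padFrozen, Finset.mem_image, Finset.mem_filter, Fintype.mem_piFinset, Finset.mem_Icc]
    refine ⟨w, ⟨fun i => hw i, μ, hμ, ?_⟩, rfl⟩
    have := hval w μ (hw μ).1 (hw μ).2
    omega

/-- **Chart of the interior** `pad ∖ frozen` (`2 ≤ S`, `c μ ∈ [-2,1]` on `M`): all offsets `≤ 3` and no selected
offset on its frozen layer. [folklore] -/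
theorem mem_interior_iff_val {S : ℕ} (hS : 2 ≤ S) (x' y : TorusSite 4 (2 * S + 1)) (M : Finset (Fin 4))
    (c : Fin 4 → ℤ) :
    y ∈ ebox S x' 1 \ padFrozen S x' M c ↔
      (∀ i, (y i - x' i + 2).val ≤ 3) ∧ ∀ μ ∈ M, ((y μ - x' μ + 2).val : ℤ) ≠ c μ + 2 := by
  rw [Finset.mem_sdiff]
  constructor
  · rintro ⟨hy, hf⟩
    refine ⟨(mem_pad_iff_val hS x' y).1 hy, fun μ hμ h => hf ?_⟩
    exact (mem_padFrozen_iff_val hS x' y M c hy).2 ⟨μ, hμ, h⟩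
  · rintro ⟨hy, hf⟩
    have hy' : y ∈ ebox S x' 1 := (mem_pad_iff_val hS x' y).2 hy
    refine ⟨hy', fun h => ?_⟩
    obtain ⟨μ, hμ, h⟩ := (mem_padFrozen_iff_val hS x' y M c hy').1 h
    exact hf μ hμ h

/-- **A core site not adjacent to the frozen layers has its star inside the interior** (`2 ≤ S`): if the offsets of
`a` are `1` or `2` in every coordinate, equal to `2` where the bottom layer is frozen (`c μ = -2`) and to `1` where the
top layer is frozen (`c μ = 1`), then `a` and all its neighbours `a ± e_μ` lie in `pad ∖ frozen`. [folklore] -/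
theorem star_subset_interior {S : ℕ} (hS : 2 ≤ S) (x' a : TorusSite 4 (2 * S + 1)) (M : Finset (Fin 4))
    (c : Fin 4 → ℤ) (hc : ∀ μ ∈ M, c μ = -2 ∨ c μ = 1)
    (ha : ∀ i, (a i - x' i + 2).val = 1 ∨ (a i - x' i + 2).val = 2)
    (hfar : ∀ μ ∈ M, (c μ = -2 → (a μ - x' μ + 2).val = 2) ∧ (c μ = 1 → (a μ - x' μ + 2).val = 1)) :
    a ∈ ebox S x' 1 \ padFrozen S x' M c ∧
      ∀ μ : Fin 4, a + Pi.single μ 1 ∈ ebox S x' 1 \ padFrozen S x' M c ∧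
        a - Pi.single μ 1 ∈ ebox S x' 1 \ padFrozen S x' M c := by
  haveI : NeZero (2 * S + 1) := ⟨by omega⟩
  have key : ∀ y : TorusSite 4 (2 * S + 1),
      (∀ i, (y i - x' i + 2).val = (a i - x' i + 2).val ∨ (y i - x' i + 2).val = (a i - x' i + 2).val + 1 ∨
        (y i - x' i + 2).val + 1 = (a i - x' i + 2).val) → y ∈ ebox S x' 1 \ padFrozen S x' M c := by
    intro y hy
    rw [mem_interior_iff_val hS x' y M c]
    refine ⟨fun i => ?_, fun μ hμ h => ?_⟩
    · rcases ha i with h | h <;> rcases hy i with h' | h' | h' <;> omega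
    · have h1 := hfar μ hμ
      rcases hc μ hμ with h2 | h2 <;> rcases ha μ with h3 | h3 <;> rcases hy μ with h' | h' | h' <;>
        [omega; omega; omega; omega; omega; omega; omega; omega; omega; omega; omega; omega]
  have hup : ∀ μ i, ((a + Pi.single μ 1 : TorusSite 4 (2 * S + 1)) i - x' i + 2).val =
      (a i - x' i + 2).val ∨ ((a + Pi.single μ 1 : TorusSite 4 (2 * S + 1)) i - x' i + 2).val =
        (a i - x' i + 2).val + 1 ∨
      ((a + Pi.single μ 1 : TorusSite 4 (2 * S + 1)) i - x' i + 2).val + 1 = (a i - x' i + 2).val := by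
    intro μ i
    rw [(add_single_apply a μ i).1]
    by_cases h : i = μ
    · rw [if_pos h]
      right; left
      rw [show a i + 1 - x' i + 2 = (a i - x' i + 2) + 1 by ring]
      exact val_add_one_of_lt _ (by rcases ha i with h' | h' <;> omega)
    · rw [if_neg h]; left; rfl
  have hdn : ∀ μ i, ((a - Pi.single μ 1 : TorusSite 4 (2 * S + 1)) i - x' i + 2).val =
      (a i - x' i + 2).val ∨ ((a - Pi.single μ 1 : TorusSite 4 (2 * S + 1)) i - x' i + 2).val =
        (a i - x' i + 2).val + 1 ∨
      ((a - Pi.single μ 1 : TorusSite 4 (2 * S + 1)) i - x' i + 2).val + 1 = (a i - x' i + 2).val := by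
    intro μ i
    rw [(add_single_apply a μ i).2]
    by_cases h : i = μ
    · rw [if_pos h]
      right; right
      rw [show a i - 1 - x' i + 2 = (a i - x' i + 2) - 1 by ring]
      rw [val_sub_one_of_le _ (by rcases ha i with h' | h' <;> omega)]
      rcases ha i with h' | h' <;> omega
    · rw [if_neg h]; left; rfl
  exact ⟨key a fun i => Or.inl rfl, fun μ => ⟨key _ (hup μ), key _ (hdn μ)⟩⟩

open Classical in
/-- With the star of `a` inside the interior, every star link of `a` is a forced link. [folklore] -/
theorem star_subset_forced {S : ℕ} (x' a : TorusSite 4 (2 * S + 1)) (M : Finset (Fin 4)) (c : Fin 4 → ℤ)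
    (h : a ∈ ebox S x' 1 \ padFrozen S x' M c ∧
      ∀ μ : Fin 4, a + Pi.single μ 1 ∈ ebox S x' 1 \ padFrozen S x' M c ∧
        a - Pi.single μ 1 ∈ ebox S x' 1 \ padFrozen S x' M c) :
    ∀ e ∈ starLinks S a, e.1 ∈ ebox S x' 1 \ padFrozen S x' M c ∧
      e.1.shift e.2 ∈ ebox S x' 1 \ padFrozen S x' M c := by
  intro e he
  simp only [starLinks, Finset.mem_filter, Finset.mem_univ, true_and] at he
  rcases he with he | he
  · refine ⟨he ▸ h.1, ?_⟩
    show e.1 + Pi.single e.2 1 ∈ _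
    rw [he]; exact (h.2 e.2).1
  · have h1 : e.1 = a - Pi.single e.2 1 := eq_sub_of_add_eq he
    exact ⟨by rw [h1]; exact (h.2 e.2).2, by rw [he]; exact h.1⟩

/-- The region `stars ∪ Q₁ ∪ Q₂` with `Qᵢ` made of pad links has at most `2064` links. [folklore] -/
theorem card_region_le {S : ℕ} (a b x' y' : TorusSite 4 (2 * S + 1)) (Q₁ Q₂ : Finset (Edge 4 (2 * S + 1)))
    (h₁ : Q₁ ⊆ padLinks S x') (h₂ : Q₂ ⊆ padLinks S y') :
    (starLinks S a ∪ starLinks S b ∪ Q₁ ∪ Q₂).card ≤ 2064 := by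
  classical
  haveI : NeZero (2 * S + 1) := ⟨by omega⟩
  have e1 : starLinks S a ∪ starLinks S b ∪ Q₁ ∪ Q₂ ⊆ starLinks S a ∪ starLinks S b ∪ padLinks S x' ∪ padLinks S y' :=
    Finset.union_subset_union (Finset.union_subset_union le_rfl h₁) h₂
  refine (Finset.card_le_card e1).trans ?_
  have h := card_stars_union_pads_le (S := S) a b x' y'
  simp only [starLinks, padLinks] at h ⊢
  convert h using 2

/-! ## §2 Balance of a touched region from an `R`-pairing with rungs -/

/-- **Balance by an `R`-pairing.**  Let every link of `R` join two sites of the block `P₁`, two sites of `P₂`, or be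
a rung (`∈ Rg ⊆ R`), and let every nearest-neighbour link inside a block belong to `R`.  Suppose `σ` pairs every
site `z ∈ A` that lies in a block or is an endpoint of a rung with both endpoints in `A`: `σ z ∈ A`, `σ (σ z) = z`,
and `σ z = z ± e_μ` through a link lying inside a block or belonging to `Rg`.  Then the touched region of `R` in `A`
is bipartite-balanced (bodies of the skeleton's `touched` / `Balanced`). [folklore] -/
theorem balanced_touched_of_pairing {N : ℕ} (A : Finset (TorusSite 4 N)) (R Rg : Finset (Edge 4 N))
    (P₁ P₂ : Finset (TorusSite 4 N)) (σ : TorusSite 4 N → TorusSite 4 N)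
    (hR : ∀ e ∈ R, (e.1 ∈ P₁ ∧ Site.shift e.1 e.2 ∈ P₁) ∨ (e.1 ∈ P₂ ∧ Site.shift e.1 e.2 ∈ P₂) ∨ e ∈ Rg)
    (hP₁ : ∀ (z : TorusSite 4 N) (μ : Fin 4), z ∈ P₁ → z + Pi.single μ 1 ∈ P₁ → ((z, μ) : Edge 4 N) ∈ R)
    (hP₂ : ∀ (z : TorusSite 4 N) (μ : Fin 4), z ∈ P₂ → z + Pi.single μ 1 ∈ P₂ → ((z, μ) : Edge 4 N) ∈ R)
    (hRg : Rg ⊆ R)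
    (hσ : ∀ z : TorusSite 4 N, z ∈ A →
      (z ∈ P₁ ∨ z ∈ P₂ ∨ ∃ e ∈ Rg, e.1 ∈ A ∧ Site.shift e.1 e.2 ∈ A ∧ (e.1 = z ∨ Site.shift e.1 e.2 = z)) →
      σ z ∈ A ∧ σ (σ z) = z ∧ ∃ μ : Fin 4,
        (σ z = z + Pi.single μ 1 ∧ ((z ∈ P₁ ∧ σ z ∈ P₁) ∨ (z ∈ P₂ ∧ σ z ∈ P₂) ∨ ((z, μ) : Edge 4 N) ∈ Rg)) ∨
        (z = σ z + Pi.single μ 1 ∧ ((z ∈ P₁ ∧ σ z ∈ P₁) ∨ (z ∈ P₂ ∧ σ z ∈ P₂) ∨ ((σ z, μ) : Edge 4 N) ∈ Rg)))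
    (χ : TorusSite 4 N → Bool) :
    (∀ z ∈ A.filter (fun z => ∃ e ∈ R, e.1 ∈ A ∧ Site.shift e.1 e.2 ∈ A ∧ (e.1 = z ∨ Site.shift e.1 e.2 = z)),
      ∀ μ : Fin 4, z + Pi.single μ 1 ∈
        A.filter (fun z => ∃ e ∈ R, e.1 ∈ A ∧ Site.shift e.1 e.2 ∈ A ∧ (e.1 = z ∨ Site.shift e.1 e.2 = z)) →
        χ z ≠ χ (z + Pi.single μ 1)) →
    ((A.filter (fun z => ∃ e ∈ R, e.1 ∈ A ∧ Site.shift e.1 e.2 ∈ A ∧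
        (e.1 = z ∨ Site.shift e.1 e.2 = z))).filter fun z => χ z = true).card =
      ((A.filter (fun z => ∃ e ∈ R, e.1 ∈ A ∧ Site.shift e.1 e.2 ∈ A ∧
        (e.1 = z ∨ Site.shift e.1 e.2 = z))).filter fun z => χ z = false).card := by
  intro hχ
  set X : Finset (TorusSite 4 N) := A.filter (fun z => ∃ e ∈ R, e.1 ∈ A ∧ Site.shift e.1 e.2 ∈ A ∧
    (e.1 = z ∨ Site.shift e.1 e.2 = z)) with hXdef
  -- every touched site is in `A` and lies in a block or on an `A`-rung
  have hcase : ∀ z ∈ X, z ∈ A ∧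
      (z ∈ P₁ ∨ z ∈ P₂ ∨ ∃ e ∈ Rg, e.1 ∈ A ∧ Site.shift e.1 e.2 ∈ A ∧ (e.1 = z ∨ Site.shift e.1 e.2 = z)) := by
    intro z hz
    rw [hXdef, Finset.mem_filter] at hz
    obtain ⟨hzA, e, heR, h1A, h2A, hez⟩ := hz
    refine ⟨hzA, ?_⟩
    rcases hR e heR with ⟨h1, h2⟩ | ⟨h1, h2⟩ | hg
    · left; rcases hez with h | h <;> [exact h ▸ h1; exact h ▸ h2]
    · right; left; rcases hez with h | h <;> [exact h ▸ h1; exact h ▸ h2]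
    · right; right; exact ⟨e, hg, h1A, h2A, hez⟩
  -- the partner of a touched site is touched
  have hσX : ∀ z ∈ X, σ z ∈ X := by
    intro z hz
    obtain ⟨hzA, hc⟩ := hcase z hz
    obtain ⟨hσA, -, μ, hμ⟩ := hσ z hzA hc
    rw [hXdef, Finset.mem_filter]
    refine ⟨hσA, ?_⟩
    rcases hμ with ⟨he, hw⟩ | ⟨he, hw⟩
    · -- the link `(z, μ)` from `z` up to `σ z`
      have hlink : ((z, μ) : Edge 4 N) ∈ R := by
        rcases hw with ⟨h1, h2⟩ | ⟨h1, h2⟩ | h3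
        · exact hP₁ z μ h1 (he ▸ h2)
        · exact hP₂ z μ h1 (he ▸ h2)
        · exact hRg h3
      refine ⟨(z, μ), hlink, hzA, ?_, Or.inr ?_⟩
      · show z + Pi.single μ 1 ∈ A
        rw [← he]; exact hσA
      · show z + Pi.single μ 1 = σ z
        exact he.symm
    · have hlink : ((σ z, μ) : Edge 4 N) ∈ R := by
        rcases hw with ⟨h1, h2⟩ | ⟨h1, h2⟩ | h3
        · exact hP₁ (σ z) μ h2 (he ▸ h1)
        · exact hP₂ (σ z) μ h2 (he ▸ h1)
        · exact hRg h3
      refine ⟨(σ z, μ), hlink, hσA, ?_, Or.inl rfl⟩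
      show σ z + Pi.single μ 1 ∈ A
      rw [← he]; exact hzA
  refine card_filter_eq_of_pairing X σ hσX (fun z hz => (hσ z (hcase z hz).1 (hcase z hz).2).2.1)
    (fun z hz => ?_) χ hχ
  obtain ⟨-, -, μ, hμ⟩ := hσ z (hcase z hz).1 (hcase z hz).2
  exact ⟨μ, hμ.imp (fun h => h.1) (fun h => h.1)⟩

/-! ## §3 The first-coordinate flip -/

/-- **The first-coordinate flip is a nearest-neighbour involution.**  Given per-coordinate predicates `P j` and maps
`π j` preserving `P j`, involutive on it and moving by `±1`, the map flipping the FIRST coordinate `j` with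
`P j (y j)` (identity if none) satisfies, at every `y` having such a coordinate: it flips exactly the least such `j`,
is involutive, and moves `y` to a `j`-neighbour. [folklore] -/
theorem first_coord_flip {N : ℕ} (P : Fin 4 → ZMod N → Prop) [∀ j, DecidablePred (P j)]
    (π : Fin 4 → ZMod N → ZMod N)
    (hπ : ∀ j u, P j u → P j (π j u) ∧ π j (π j u) = u ∧ (π j u = u + 1 ∨ u = π j u + 1)) :
    let σ : TorusSite 4 N → TorusSite 4 N := fun y =>
      if P 0 (y 0) then Function.update y 0 (π 0 (y 0)) else
      if P 1 (y 1) then Function.update y 1 (π 1 (y 1)) else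
      if P 2 (y 2) then Function.update y 2 (π 2 (y 2)) else
      if P 3 (y 3) then Function.update y 3 (π 3 (y 3)) else y
    ∀ y : TorusSite 4 N, (∃ j, P j (y j)) → ∃ j, P j (y j) ∧ (∀ i, i < j → ¬ P i (y i)) ∧
      σ y = Function.update y j (π j (y j)) ∧ σ (σ y) = y ∧
      (σ y = y + Pi.single j 1 ∨ y = σ y + Pi.single j 1) := by
  intro σ y hy
  -- generic step: if `σ` flips coordinate `j` at `y` and at the flipped site, everything follows
  have hσdef : ∀ v : TorusSite 4 N, σ v =
      if P 0 (v 0) then Function.update v 0 (π 0 (v 0)) else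
      if P 1 (v 1) then Function.update v 1 (π 1 (v 1)) else
      if P 2 (v 2) then Function.update v 2 (π 2 (v 2)) else
      if P 3 (v 3) then Function.update v 3 (π 3 (v 3)) else v := fun v => rfl
  have step : ∀ j : Fin 4, P j (y j) → (∀ i, i < j → ¬ P i (y i)) →
      (∀ v : TorusSite 4 N, P j (v j) → (∀ i, i < j → ¬ P i (v i)) → σ v = Function.update v j (π j (v j))) →
      ∃ j, P j (y j) ∧ (∀ i, i < j → ¬ P i (y i)) ∧ σ y = Function.update y j (π j (y j)) ∧ σ (σ y) = y ∧
        (σ y = y + Pi.single j 1 ∨ y = σ y + Pi.single j 1) := by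
    intro j hj hmin hflip
    have h1 : σ y = Function.update y j (π j (y j)) := hflip y hj hmin
    obtain ⟨hP', hinv, hnn⟩ := hπ j (y j) hj
    have h2 : σ (σ y) = Function.update (σ y) j (π j (σ y j)) := by
      refine hflip (σ y) ?_ ?_
      · rw [h1, Function.update_self]; exact hP'
      · intro i hi
        rw [h1, Function.update_of_ne (ne_of_lt hi)]
        exact hmin i hi
    refine ⟨j, hj, hmin, h1, ?_, ?_⟩
    · rw [h2, h1]
      simp only [Function.update_self, Function.update_idem, hinv, Function.update_eq_self]
    · rcases hnn with h | h
      · left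
        rw [h1]; funext i
        by_cases hi : i = j
        · subst hi; simp [h]
        · simp [hi]
      · right
        rw [h1]; funext i
        by_cases hi : i = j
        · subst hi; simp; exact h
        · simp [hi]
  by_cases h0 : P 0 (y 0)
  · refine step 0 h0 (fun i hi => absurd hi (Fin.not_lt_zero i)) fun v hv _ => ?_
    rw [hσdef, if_pos hv]
  by_cases h1 : P 1 (y 1)
  · refine step 1 h1 (fun i hi => ?_) fun v hv hmin => ?_
    · have : i = 0 := by omega
      subst this; exact h0
    · rw [hσdef, if_neg (hmin 0 (by decide)), if_pos hv]
  by_cases h2 : P 2 (y 2)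
  · refine step 2 h2 (fun i hi => ?_) fun v hv hmin => ?_
    · have : i = 0 ∨ i = 1 := by omega
      rcases this with rfl | rfl <;> assumption
    · rw [hσdef, if_neg (hmin 0 (by decide)), if_neg (hmin 1 (by decide)), if_pos hv]
  by_cases h3 : P 3 (y 3)
  · refine step 3 h3 (fun i hi => ?_) fun v hv hmin => ?_
    · have : i = 0 ∨ i = 1 ∨ i = 2 := by omega
      rcases this with rfl | rfl | rfl <;> assumption
    · rw [hσdef, if_neg (hmin 0 (by decide)), if_neg (hmin 1 (by decide)), if_neg (hmin 2 (by decide)), if_pos hv]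
  · exfalso
    obtain ⟨j, hj⟩ := hy
    have : j = 0 ∨ j = 1 ∨ j = 2 ∨ j = 3 := by omega
    rcases this with rfl | rfl | rfl | rfl <;> contradiction

/-- **Registered helper `stub_placementSides_aux2` of crux stmt-QuantumFields-17375** (line `pad-the-fibre`, stub
`stub_placementSides`): balance of a touched region from an `R`-pairing with rungs (§2). [folklore] -/
theorem stub_placementSides_aux2 : ∀ (N : ℕ) (A : Finset (TorusSite 4 N)) (R Rg : Finset (Edge 4 N)) (P₁ P₂ : Finset (TorusSite 4 N)) (σ : TorusSite 4 N → TorusSite 4 N), (∀ e ∈ R, (e.1 ∈ P₁ ∧ Site.shift e.1 e.2 ∈ P₁) ∨ (e.1 ∈ P₂ ∧ Site.shift e.1 e.2 ∈ P₂) ∨ e ∈ Rg) → (∀ (z : TorusSite 4 N) (μ : Fin 4), z ∈ P₁ → z + Pi.single μ 1 ∈ P₁ → ((z, μ) : Edge 4 N) ∈ R) → (∀ (z : TorusSite 4 N) (μ : Fin 4), z ∈ P₂ → z + Pi.single μ 1 ∈ P₂ → ((z, μ) : Edge 4 N) ∈ R) → Rg ⊆ R → (∀ z : TorusSite 4 N,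 z ∈ A → (z ∈ P₁ ∨ z ∈ P₂ ∨ ∃ e ∈ Rg, e.1 ∈ A ∧ Site.shift e.1 e.2 ∈ A ∧ (e.1 = z ∨ Site.shift e.1 e.2 = z)) → σ z ∈ A ∧ σ (σ z) = z ∧ ∃ μ : Fin 4, (σ z = z + Pi.single μ 1 ∧ ((z ∈ P₁ ∧ σ z ∈ P₁) ∨ (z ∈ P₂ ∧ σ z ∈ P₂) ∨ ((z, μ) : Edge 4 N) ∈ Rg)) ∨ (z = σ z + Pi.single μ 1 ∧ ((z ∈ P₁ ∧ σ z ∈ P₁) ∨ (z ∈ P₂ ∧ σ z ∈ P₂) ∨ ((σ z, μ) : Edge 4 N) ∈ Rg))) → ∀ (χ : TorusSite 4 N → Bool), (∀ z ∈ A.filter (fun z => ∃ e ∈ R, e.1 ∈ A ∧ Site.shift e.1 e.2 ∈ A ∧ (e.1 = z ∨ Site.shift e.1 e.2 = z)), ∀ μ : Fin 4, z + Pi.single μ 1 ∈ A.filter (fun z => ∃ e ∈ R, e.1 ∈ A ∧ Site.shift e.1 e.2 ∈ A ∧ (e.1 = z ∨ Site.shift e.1 e.2 = z)) → χ z ≠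 χ (z + Pi.single μ 1)) → ((A.filter (fun z => ∃ e ∈ R, e.1 ∈ A ∧ Site.shift e.1 e.2 ∈ A ∧ (e.1 = z ∨ Site.shift e.1 e.2 = z))).filter fun z => χ z = true).card = ((A.filter (fun z => ∃ e ∈ R, e.1 ∈ A ∧ Site.shift e.1 e.2 ∈ A ∧ (e.1 = z ∨ Site.shift e.1 e.2 = z))).filter fun z => χ z = false).card :=
  fun _ A R Rg P₁ P₂ σ hR hP₁ hP₂ hRg hσ χ => balanced_touched_of_pairing A R Rg P₁ P₂ σ hR hP₁ hP₂ hRg hσ χ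

end Summit.QuantumFields.QCD.Theorems.PadTheFibreTwoStar

end
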